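import Summits.HodgeConjecture.HodgeConjecture.Theorems.MarkmanPartnerTransportPicardThreeK3SquaresRealMultiplicationType
import Summits.HodgeConjecture.HodgeConjecture.Theorems.MarkmanPartnerTransportPicardThreeK3SquaresNLAscent
import Summits.HodgeConjecture.HodgeConjecture.Theorems.MarkmanPartnerTransportPicardThreeK3SquaresNLAscentQuadratic

/-!
# Route MarkmanPartnerTransport · crux `PicardThreeK3Squares` (stmt-HodgeConjecture-19652) —
# «RM-GEN-K3» corollaries: the trichotomy with TYPES, the Noether–Lefschetz ascent in INTRINSIC type form,
# and the Picard numbers `8, 12, 14, 16` (real QUADRATIC multiplication forced)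

Sequel to `…RealMultiplicationType` (`exists_isRealMultiplicationK3_of_not_hasComplexMultiplication`: a non-CM,
non-scalar projective K3 surface is an RM K3 surface `IsRealMultiplicationK3 S ρ(S) P` of a definite type
`(ρ(S), deg P, m)`, `deg P · m + ρ(S) = 22`). Consequences, all modulo the marking fact only unless displayed:

* `scalar_or_hasComplexMultiplication_or_isRealMultiplicationK3` — **Zarhin's trichotomy with types**: every
  projective K3 surface is scalar (`End_Hdg(T) = ℚ`), CM, or an RM K3 surface of a type `(ρ, d, m)` with `d ≥ 2`,
  `m ≥ 3`, `d · m + ρ = 22`.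
* `picardThreeK3Squares_of_isRealMultiplicationK3` — **lossless split**: granted Buskin + markings, the crux IS the Hodge
  conjecture for the squares of the RM K3 surfaces `IsRealMultiplicationK3 S ρ(S) P` of the fifteen types with `ρ ≥ 3`
  (K3-side twin of «CELL-SPLIT» for crux #5).
* `hodgeConjectureFor_square_of_nlAscent_type`, `picardThreeK3Squares_of_nlAscent_type` — the NL-ASCENT of
  `…NLAscent` with its inputs INTRINSIC: the crux `PicardThreeK3Squares` follows from Buskin, markings, the
  displayed ascent families for the RM K3 surfaces of the types with `ρ ≥ d + 4` (moduli input (I1′)), and HC⁴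
  for the RM K3 surfaces of the five TERMINAL types `(ρ, d) ∈ {(4,2), (4,3), (6,4), (7,5), (4,6)}` — both
  hypotheses now quantified over van Geemen–Schütt's `IsRealMultiplicationK3 S ρ P`, `P` irreducible, `d = deg P`
  (the `¬ Terminal` / `Terminal` case split of `picardThreeK3Squares_of_nlAscent_terminal` is discharged by
  «RM-GEN-K3» and `four_add_le_or_terminal`).
* `natDegree_eq_two_of_rank`, `exists_isRealMultiplicationK3_quadratic_of_rank` — at `ρ(S) ∈ {8, 12, 14, 16}`
  (`22 − ρ ∈ {14, 10, 8, 6}` has no factorisation `d · m` with `d ≥ 3`, `m ≥ 3`) a non-CM, non-scalar K3 surface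
  has real QUADRATIC multiplication (`deg P = 2`);
* `hodgeConjectureFor_square_of_rank_mem` — hence **HC⁴(`S ⊗ S`) for EVERY projective K3 surface with
  `ρ(S) ∈ {8, 12, 14, 16}`** (the whole Kuga–Satake range `ρ ≥ 12` of the real-multiplication ranks, Varesco's
  `ρ = 16` sector included, and `ρ = 8`) GRANTED Buskin, markings, the displayed QUADRATIC ascent families of
  `…NLAscentQuadratic` and HC⁴ for the non-CM quadratic-RM K3 squares of Picard number `2` (crux #5's cell
  `(3, 2)` in K3 form) — no hypothesis on `S` beyond its Picard number.

No definition, no sorry, no new named fact; nothing here proves the crux, the cell, or any instance of HC.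
Prover seat hodge-nonav-19652-p1 (gen 19), `--supports stmt-HodgeConjecture-19652`.

References: Yu. G. Zarhin, J. reine angew. Math. 341 (1983) Thm. 1.5.1; B. van Geemen, Michigan Math. J. 56 (2008)
Lemma 3.2; B. van Geemen, M. Schütt, Forum Math. Sigma 13 (2025) e2, §2.1, §2.6, Prop. 3.2, §3.4; C. Voisin,
*Hodge Theory II*, §7.3.2; N. Buskin, J. reine angew. Math. 755 (2019) Thm. 1.1; M. Varesco, Michigan Math. J.
75 (2025).
-/

set_option linter.dupNamespace false

noncomputable section

namespace Summit.HodgeConjecture.HodgeConjecture.Theorems.MarkmanPartnerTransport.RealMultiplicationType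

open CategoryTheory MonoidalCategory CartesianMonoidalCategory AlgebraicGeometry Polynomial
open Literature.AlgebraicGeometry Literature.AlgebraicGeometry.Motives Literature.AlgebraicGeometry.HodgeTheory
open Literature.AlgebraicGeometry.Surfaces
open Literature.AlgebraicTopology.SingularHomology
open Summit.HodgeConjecture.HodgeConjecture.Theorems
open Summit.HodgeConjecture.HodgeConjecture.Theorems.NikulinTwinTransport
open Summit.HodgeConjecture.HodgeConjecture.Theorems.MarkmanPartnerTransport.RealMultiplicationRanks
open Summit.HodgeConjecture.HodgeConjecture.Theorems.MarkmanPartnerTransport.NLAscent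

variable {S : SchemeOver ℂ}

/-- `Corr[μ, hS ; γ, y] = fst_*(snd^* y ∪ γ)` on `H²(S(ℂ); ℂ)`. Local notation only. -/
local notation3 (prettyPrint := false) "Corr[" μ ", " hS " ; " γ ", " y "]" =>
  complexGysin μ (IsSmoothProjective.tensor_holds hS hS) hS
    (SemiCartesianMonoidalCategory.fst _ _) (rfl : 2 * 1 + 2 * 2 + 2 * 2 = 2 * 1 + 2 * (2 + 2))
    (cupProduct (rfl : 2 * 1 + 2 * 2 = 2 * 1 + 2 * 2)
      (complexBetti.map (SemiCartesianMonoidalCategory.snd _ _) (2 * 1) y) γ)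

/-- `Scalar[S]`: «`End_Hdg(T(S)) = ℚ`» — VERBATIM the scalar clause of `…NLAscent`. Local notation only. -/
local notation3 (prettyPrint := false) "Scalar[" S "]" =>
  (∀ (f : complexBetti S (2 * 1) →ₗ[ℂ] complexBetti S (2 * 1)),
    (∀ y, IsRationalClass y → IsRationalClass (f y)) →
    (∀ (i j : ℕ) y, IsOfHodgeType 2 S (2 * 1) i j y → IsOfHodgeType 2 S (2 * 1) i j (f y)) →
    (∀ d ∈ algebraicClasses S 1, f d = 0) →
    (∀ y : complexBetti S (2 * 1), ∀ d ∈ algebraicClasses S 1,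
      cupProduct (rfl : 2 * 1 + 2 * 1 = 2 * 2) (f y) d = 0) →
    ∃ a : ℚ, ∀ y : complexBetti S (2 * 1),
      (∀ d ∈ algebraicClasses S 1, cupProduct (rfl : 2 * 1 + 2 * 1 = 2 * 2) y d = 0) →
        f y = (a : ℂ) • y)

/-- `NLAscentFamily[S, hS]`: VERBATIM the displayed Noether–Lefschetz ascent family of `…NLAscent`. Local
notation only. [cite: GeemenSchutt2023, §2.6 and Prop. 3.2] [cite: VoisinHodgeII2003, §5.3.4 and §7.3.2] -/
local notation3 (prettyPrint := false) "NLAscentFamily[" S ", " hS "]" =>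
  (∃ (t f : complexBetti S (2 * 1) →ₗ[ℂ] complexBetti S (2 * 1)),
    (∀ y, IsRationalClass y → IsRationalClass (t y)) ∧
    (∀ d ∈ algebraicClasses S 1, t d = 0) ∧
    TranscendentalEndomorphismsGeneratedBy S t ∧
    (∀ y, f y ∈ algebraicClasses S 1) ∧
    (∀ y : complexBetti S (2 * 1),
      (∀ d ∈ algebraicClasses S 1, cupProduct (rfl : 2 * 1 + 2 * 1 = 2 * 2) y d = 0) → f y = 0) ∧
    ∃ (𝒳 B : SchemeOver ℂ) (g : 𝒳 ⟶ B),
      IsSmoothProjectiveFamily g 4 ∧ IsQuasiProjectiveOver 𝒳 ∧ IsQuasiProjectiveOver B ∧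
      AlgebraicGeometry.Smooth B.hom ∧ IrreducibleSpace B.left ∧
      ∃ (σ : ComplexPoints B → FiberClass g (2 * 2)) (hpt : ∀ b, (σ b).pt = b), Continuous σ ∧
      ∃ (b₁ : ComplexPoints B) (e₁ : S ⊗ S ≅ fiberOver g b₁),
        (∀ y : complexBetti S (2 * 1),
          t y + f y = Corr[complexOrientationFamily, hS ;
            complexBetti.map e₁.hom (2 * 2) ((σ b₁).clsAt (hpt b₁)), y]) ∧
        ∀ᶠ b in residual (ComplexPoints B),
          IsRationalClass ((σ b).clsAt (hpt b)) ∧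
          IsOfHodgeType 4 (fiberOver g b) (2 * 2) 2 2 ((σ b).clsAt (hpt b)) ∧
          ∃ (S' : SchemeOver ℂ) (_ : IsK3Surface S') (_ : fiberOver g b ≅ S' ⊗ S'),
            3 ≤ Module.finrank ℂ ↥(algebraicClasses S' 1) ∧
            Module.finrank ℂ ↥(algebraicClasses S' 1) < Module.finrank ℂ ↥(algebraicClasses S 1))

/-- `Quadratic[S]`: VERBATIM the `Quadratic[S]` binder of `…NLAscentQuadratic` (a displayed generator with an
irreducible QUADRATIC annihilating polynomial). Local notation only. [cite: GeemenSchutt2023, §2.1 and §3.9] -/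
local notation3 (prettyPrint := false) "Quadratic[" S "]" =>
  (∃ (t : complexBetti S (2 * 1) →ₗ[ℂ] complexBetti S (2 * 1)) (P : ℚ[X]),
    (∀ y, IsRationalClass y → IsRationalClass (t y)) ∧
    (∀ (i j : ℕ) (y : complexBetti S (2 * 1)),
      IsOfHodgeType 2 S (2 * 1) i j y → IsOfHodgeType 2 S (2 * 1) i j (t y)) ∧
    (∀ d ∈ algebraicClasses S 1, t d = 0) ∧
    (∀ (y : complexBetti S (2 * 1)), ∀ d ∈ algebraicClasses S 1,
      cupProduct (rfl : 2 * 1 + 2 * 1 = 2 * 2) (t y) d = 0) ∧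
    Irreducible P ∧ P.natDegree = 2 ∧ IsAnnihilatedOnTranscendentalBy S t P ∧
    TranscendentalEndomorphismsGeneratedBy S t)

/-- `NLAscentFamily₂[S, hS]`: VERBATIM the displayed QUADRATIC ascent family of `…NLAscentQuadratic`. Local
notation only. [cite: GeemenSchutt2023, §2.6, Prop. 3.2 and §6.6] [cite: VoisinHodgeII2003, §5.3.4 and §7.3.2] -/
local notation3 (prettyPrint := false) "NLAscentFamily₂[" S ", " hS "]" =>
  (∃ (t f : complexBetti S (2 * 1) →ₗ[ℂ] complexBetti S (2 * 1)),
    (∀ y, IsRationalClass y → IsRationalClass (t y)) ∧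
    (∀ d ∈ algebraicClasses S 1, t d = 0) ∧
    TranscendentalEndomorphismsGeneratedBy S t ∧
    (∀ y, f y ∈ algebraicClasses S 1) ∧
    (∀ y : complexBetti S (2 * 1),
      (∀ d ∈ algebraicClasses S 1, cupProduct (rfl : 2 * 1 + 2 * 1 = 2 * 2) y d = 0) → f y = 0) ∧
    ∃ (𝒳 B : SchemeOver ℂ) (g : 𝒳 ⟶ B),
      IsSmoothProjectiveFamily g 4 ∧ IsQuasiProjectiveOver 𝒳 ∧ IsQuasiProjectiveOver B ∧
      AlgebraicGeometry.Smooth B.hom ∧ IrreducibleSpace B.left ∧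
      ∃ (σ : ComplexPoints B → FiberClass g (2 * 2)) (hpt : ∀ b, (σ b).pt = b), Continuous σ ∧
      ∃ (b₁ : ComplexPoints B) (e₁ : S ⊗ S ≅ fiberOver g b₁),
        (∀ y : complexBetti S (2 * 1),
          t y + f y = Corr[complexOrientationFamily, hS ;
            complexBetti.map e₁.hom (2 * 2) ((σ b₁).clsAt (hpt b₁)), y]) ∧
        ∀ᶠ b in residual (ComplexPoints B),
          IsRationalClass ((σ b).clsAt (hpt b)) ∧
          IsOfHodgeType 4 (fiberOver g b) (2 * 2) 2 2 ((σ b).clsAt (hpt b)) ∧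
          ∃ (S' : SchemeOver ℂ) (_ : IsK3Surface S') (_ : fiberOver g b ≅ S' ⊗ S'),
            Quadratic[S'] ∧
            Module.finrank ℂ ↥(algebraicClasses S' 1) + 2 = Module.finrank ℂ ↥(algebraicClasses S 1))

/-! ### The trichotomy with types -/

/-- **Zarhin's trichotomy with types.** Every projective K3 surface `S` (granted markings) is scalar
(`End_Hdg(T(S)) = ℚ`), of CM type, or a real-multiplication K3 surface `IsRealMultiplicationK3 S ρ(S) P` of a
definite type: `P` irreducible, `2 ≤ deg P`, `deg P · m + ρ(S) = 22` with `m ≥ 3`.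
[cite: Zarhin1983HodgeGroupsK3, Thm. 1.5.1] [cite: Vangeemen2008, Lemma 3.2] [cite: GeemenSchutt2023, §2.1] -/
theorem scalar_or_hasComplexMultiplication_or_isRealMultiplicationK3 (hmark : Huybrechts_K3_marking_exists)
    (hS : IsK3Surface S) :
    Scalar[S] ∨ HasComplexMultiplication S ∨
      ∃ (P : ℚ[X]) (m : ℕ), Irreducible P ∧ 2 ≤ P.natDegree ∧ 3 ≤ m ∧
        P.natDegree * m + Module.finrank ℂ ↥(algebraicClasses S 1) = 22 ∧
        IsRealMultiplicationK3 S (Module.finrank ℂ ↥(algebraicClasses S 1)) P := by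
  by_cases hQ : Scalar[S]
  · exact Or.inl hQ
  by_cases hCM : HasComplexMultiplication S
  · exact Or.inr (Or.inl hCM)
  exact Or.inr (Or.inr (exists_isRealMultiplicationK3_of_not_hasComplexMultiplication hmark hS hCM hQ))

/-- **Crux `PicardThreeK3Squares` is EXACTLY the Hodge conjecture for the squares of van Geemen–Schütt's RM K3
surfaces with `ρ ≥ 3`** (lossless, no moduli input): GRANTED Buskin's Thm. 1.1 (CM third) and markings (scalar third:
the kernel theorem), the route item follows from HC⁴(`S ⊗ S`) for the RM K3 surfaces `IsRealMultiplicationK3 S ρ(S) P`,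
`P` irreducible of degree `d ≥ 2`, of the fifteen types `(ρ, d, m)` with `d · m + ρ = 22`, `m ≥ 3`, `ρ ≥ 3` — the
K3-side twin of «CELL-SPLIT» (`PartnerLattice.lowPicardRealMultiplication_of_six_cells`).
[cite: Zarhin1983HodgeGroupsK3, Thm. 1.5.1] [cite: Vangeemen2008, Lemma 3.2] [cite: Buskin2019, Thm. 1.1]
[cite: GeemenSchutt2023, §2.1] -/
theorem picardThreeK3Squares_of_isRealMultiplicationK3 (hB : Buskin2019_hodgeIsometry_algebraic)
    (hmark : Huybrechts_K3_marking_exists)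
    (hRM : ∀ (S : SchemeOver ℂ) (P : ℚ[X]) (m : ℕ), Irreducible P → 2 ≤ P.natDegree → 3 ≤ m →
      P.natDegree * m + Module.finrank ℂ ↥(algebraicClasses S 1) = 22 →
      IsRealMultiplicationK3 S (Module.finrank ℂ ↥(algebraicClasses S 1)) P →
      3 ≤ Module.finrank ℂ ↥(algebraicClasses S 1) → HodgeConjectureFor 4 (S ⊗ S)) :
    Summit.HodgeConjecture.HodgeConjecture.Theses.MarkmanPartnerTransport.PicardThreeK3Squares := by
  intro S hS η p x _ hρ
  rcases scalar_or_hasComplexMultiplication_or_isRealMultiplicationK3 hmark hS with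
    hQ | hCM | ⟨P, m, hPirr, hd2, hm, hsum, hRMK3⟩
  · exact SquareGlueFree.hodgeConjectureFor_square_of_hodgeEndomorphisms_scalar hS.isSmoothProjective hQ
  · exact CMThird.hodgeConjectureFor_square_of_CM_of_buskin hB hmark S hS hCM
  · exact hRM S P m hPirr hd2 hm hsum hRMK3 hρ

/-! ### The Noether–Lefschetz ascent in intrinsic type form -/

/-- **HC⁴ for every K3 square with `ρ(S) ≥ 3` — the NL-ascent with INTRINSIC types.** GRANTED Buskin,
markings, the displayed Noether–Lefschetz ascent families for the RM K3 surfaces `IsRealMultiplicationK3 S ρ P`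
(`P` irreducible) of the types with `ρ ≥ deg P + 4` (moduli input (I1′), not constructed in the tree), and
HC⁴(`S ⊗ S`) for the RM K3 surfaces of the five TERMINAL types `(ρ, deg P) ∈ {(4,2), (4,3), (6,4), (7,5), (4,6)}`
(OPEN): `HodgeConjectureFor 4 (S ⊗ S)` for every projective K3 surface with `ρ(S) ≥ 3`. The `Terminal` case
split of `hodgeConjectureFor_square_of_nlAscent_terminal` is discharged by «RM-GEN-K3» and
`four_add_le_or_terminal`. [cite: GeemenSchutt2023, §2.6, Prop. 3.2 and §3.4] [cite: VoisinHodgeII2003, §7.3.2]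
[cite: Buskin2019, Thm. 1.1] [cite: Vangeemen2008, Lemma 3.2] -/
theorem hodgeConjectureFor_square_of_nlAscent_type (hB : Buskin2019_hodgeIsometry_algebraic)
    (hmark : Huybrechts_K3_marking_exists)
    (hAsc : ∀ (S : SchemeOver ℂ) (hS : IsK3Surface S) (P : ℚ[X]), Irreducible P →
      IsRealMultiplicationK3 S (Module.finrank ℂ ↥(algebraicClasses S 1)) P →
      P.natDegree + 4 ≤ Module.finrank ℂ ↥(algebraicClasses S 1) → NLAscentFamily[S, hS.isSmoothProjective])
    (hTerm : ∀ (S : SchemeOver ℂ) (hS : IsK3Surface S) (P : ℚ[X]), Irreducible P →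
      IsRealMultiplicationK3 S (Module.finrank ℂ ↥(algebraicClasses S 1)) P →
      (Module.finrank ℂ ↥(algebraicClasses S 1), P.natDegree) ∈
        ({(4, 2), (4, 3), (6, 4), (7, 5), (4, 6)} : Finset (ℕ × ℕ)) → HodgeConjectureFor 4 (S ⊗ S))
    (hS : IsK3Surface S) (h3 : 3 ≤ Module.finrank ℂ ↥(algebraicClasses S 1)) :
    HodgeConjectureFor 4 (S ⊗ S) := by
  refine hodgeConjectureFor_square_of_nlAscent_terminal hB hmark ?_ ?_ _ S hS rfl h3
  · intro S hS hCM h3 _ hQ hnT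
    obtain ⟨P, m, hPirr, hd2, hm, hsum, hRM⟩ :=
      exists_isRealMultiplicationK3_of_not_hasComplexMultiplication hmark hS hCM hQ
    rcases four_add_le_or_terminal h3 hd2 hm hsum with h4 | hT
    · exact hAsc S hS P hPirr hRM h4
    · obtain ⟨-, -, -, t, ht_rat, ht_typ, ht_N, ht_perp, hann, hgen⟩ := hRM
      exact absurd ⟨t, P, ht_rat, ht_typ, ht_N, ht_perp, hPirr, hann, hgen, hT⟩ hnT
  · intro S hS hCM _ hT
    obtain ⟨t, P, ht_rat, ht_typ, ht_N, ht_perp, hPirr, hann, hgen, hT⟩ := hT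
    exact hTerm S hS P hPirr ⟨hS, rfl, hCM, t, ht_rat, ht_typ, ht_N, ht_perp, hann, hgen⟩ hT

/-- **Crux `PicardThreeK3Squares` modulo the Noether–Lefschetz ascent — intrinsic type form.** GRANTED Buskin's
Thm. 1.1, markings, the displayed ascent families for the RM K3 surfaces of the types `(ρ, d, m)` with
`ρ ≥ d + 4` (a theorem of moduli theory, input (I1′)), and the Hodge conjecture for the squares of the RM K3
surfaces of the five TERMINAL types `(4,2,9), (4,3,6), (6,4,4), (7,5,3), (4,6,3)` (OPEN — the very general members
of the largest real-multiplication families), the route item `PicardThreeK3Squares` holds; every hypothesis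
is quantified over van Geemen–Schütt's `IsRealMultiplicationK3 S ρ(S) P` with `P` irreducible.
[cite: GeemenSchutt2023, §2.6, Prop. 3.2 and §3.4] [cite: VoisinHodgeII2003, §7.3.2] [cite: Buskin2019, Thm. 1.1]
[cite: Vangeemen2008, Lemma 3.2] -/
theorem picardThreeK3Squares_of_nlAscent_type (hB : Buskin2019_hodgeIsometry_algebraic)
    (hmark : Huybrechts_K3_marking_exists)
    (hAsc : ∀ (S : SchemeOver ℂ) (hS : IsK3Surface S) (P : ℚ[X]), Irreducible P →
      IsRealMultiplicationK3 S (Module.finrank ℂ ↥(algebraicClasses S 1)) P →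
      P.natDegree + 4 ≤ Module.finrank ℂ ↥(algebraicClasses S 1) → NLAscentFamily[S, hS.isSmoothProjective])
    (hTerm : ∀ (S : SchemeOver ℂ) (hS : IsK3Surface S) (P : ℚ[X]), Irreducible P →
      IsRealMultiplicationK3 S (Module.finrank ℂ ↥(algebraicClasses S 1)) P →
      (Module.finrank ℂ ↥(algebraicClasses S 1), P.natDegree) ∈
        ({(4, 2), (4, 3), (6, 4), (7, 5), (4, 6)} : Finset (ℕ × ℕ)) → HodgeConjectureFor 4 (S ⊗ S)) :
    Summit.HodgeConjecture.HodgeConjecture.Theses.MarkmanPartnerTransport.PicardThreeK3Squares := by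
  intro S hS η p x _ hρ
  exact hodgeConjectureFor_square_of_nlAscent_type hB hmark hAsc hTerm hS hρ

/-! ### Picard numbers `8, 12, 14, 16`: real QUADRATIC multiplication is forced -/

/-- The arithmetic: `d · m + ρ = 22` with `d ≥ 2`, `m ≥ 3` and `ρ ∈ {8, 12, 14, 16}` forces `d = 2`
(`14 = 2·7`, `10 = 2·5`, `8 = 2·4`, `6 = 2·3` are the only admissible factorisations).
[cite: GeemenSchutt2023, §2.1 and §3.4] -/
theorem natDegree_eq_two_of_rank {ρ d m : ℕ} (hd : 2 ≤ d) (hm : 3 ≤ m) (h : d * m + ρ = 22)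
    (hρ : ρ = 8 ∨ ρ = 12 ∨ ρ = 14 ∨ ρ = 16) : d = 2 := by
  have hd' : d ≤ 7 := by nlinarith
  interval_cases d <;> omega

/-- **At `ρ(S) ∈ {8, 12, 14, 16}` a non-CM, non-scalar projective K3 surface has real QUADRATIC multiplication**:
`IsRealMultiplicationK3 S ρ(S) P` with `P` irreducible of degree `2` («RM-GEN-K3» + `natDegree_eq_two_of_rank`).
[cite: GeemenSchutt2023, §2.1 and §3.9] [cite: Vangeemen2008, Lemma 3.2] -/
theorem exists_isRealMultiplicationK3_quadratic_of_rank (hmark : Huybrechts_K3_marking_exists)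
    (hS : IsK3Surface S) (hCM : ¬ HasComplexMultiplication S) (hQ : ¬ Scalar[S])
    (hρ : Module.finrank ℂ ↥(algebraicClasses S 1) = 8 ∨ Module.finrank ℂ ↥(algebraicClasses S 1) = 12 ∨
      Module.finrank ℂ ↥(algebraicClasses S 1) = 14 ∨ Module.finrank ℂ ↥(algebraicClasses S 1) = 16) :
    ∃ P : ℚ[X], Irreducible P ∧ P.natDegree = 2 ∧
      IsRealMultiplicationK3 S (Module.finrank ℂ ↥(algebraicClasses S 1)) P := by
  obtain ⟨P, m, hPirr, hd2, hm, hsum, hRM⟩ :=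
    exists_isRealMultiplicationK3_of_not_hasComplexMultiplication hmark hS hCM hQ
  exact ⟨P, hPirr, natDegree_eq_two_of_rank hd2 hm hsum hρ, hRM⟩

/-- The same in the `Quadratic[S]` spelling of `…NLAscentQuadratic`. [cite: GeemenSchutt2023, §2.1 and §3.9] -/
theorem quadratic_of_rank (hmark : Huybrechts_K3_marking_exists) (hS : IsK3Surface S)
    (hCM : ¬ HasComplexMultiplication S) (hQ : ¬ Scalar[S])
    (hρ : Module.finrank ℂ ↥(algebraicClasses S 1) = 8 ∨ Module.finrank ℂ ↥(algebraicClasses S 1) = 12 ∨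
      Module.finrank ℂ ↥(algebraicClasses S 1) = 14 ∨ Module.finrank ℂ ↥(algebraicClasses S 1) = 16) :
    Quadratic[S] := by
  obtain ⟨P, hPirr, hdeg, -, -, -, t, ht_rat, ht_typ, ht_N, ht_perp, hann, hgen⟩ :=
    exists_isRealMultiplicationK3_quadratic_of_rank hmark hS hCM hQ hρ
  exact ⟨t, P, ht_rat, ht_typ, ht_N, ht_perp, hPirr, hdeg, hann, hgen⟩

/-- **HC⁴(`S ⊗ S`) for EVERY projective K3 surface with `ρ(S) ∈ {8, 12, 14, 16}`, modulo the quadratic ascent and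
the Picard-number-2 cell.** GRANTED Buskin's Thm. 1.1, markings, the displayed quadratic Noether–Lefschetz ascent
families of `…NLAscentQuadratic` (moduli input (I1′), unconditional for real quadratic fields by memo NL-ASCENT
r2 §4) and HC⁴ for the non-CM quadratic-RM K3 squares of Picard number `2` (crux #5's cell `(3, 2)` in K3 form):
scalar by the kernel theorem, CM by Buskin, and otherwise real QUADRATIC multiplication is forced
(`quadratic_of_rank`), where `hodgeConjectureFor_square_of_quadratic_nlAscent_of_three_le` applies. This covers,
with NO hypothesis on `S` beyond its Picard number, the whole Kuga–Satake range `ρ ≥ 12` of the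
real-multiplication ranks (Varesco's `ρ = 16` theorem's sector included) and `ρ = 8`.
[cite: GeemenSchutt2023, §2.6, Prop. 3.2, §3.9 and §6.6] [cite: Buskin2019, Thm. 1.1] [cite: Varesco2023, §2 (p. 8)] -/
theorem hodgeConjectureFor_square_of_rank_mem (hB : Buskin2019_hodgeIsometry_algebraic)
    (hmark : Huybrechts_K3_marking_exists)
    (hAsc : ∀ (S : SchemeOver ℂ) (hS : IsK3Surface S), ¬ HasComplexMultiplication S → Quadratic[S] →
      4 ≤ Module.finrank ℂ ↥(algebraicClasses S 1) → NLAscentFamily₂[S, hS.isSmoothProjective])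
    (hCell : ∀ (S : SchemeOver ℂ) (hS : IsK3Surface S), ¬ HasComplexMultiplication S → Quadratic[S] →
      Module.finrank ℂ ↥(algebraicClasses S 1) = 2 → HodgeConjectureFor 4 (S ⊗ S))
    (hS : IsK3Surface S)
    (hρ : Module.finrank ℂ ↥(algebraicClasses S 1) = 8 ∨ Module.finrank ℂ ↥(algebraicClasses S 1) = 12 ∨
      Module.finrank ℂ ↥(algebraicClasses S 1) = 14 ∨ Module.finrank ℂ ↥(algebraicClasses S 1) = 16) :
    HodgeConjectureFor 4 (S ⊗ S) := by
  by_cases hCM : HasComplexMultiplication S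
  · exact CMThird.hodgeConjectureFor_square_of_CM_of_buskin hB hmark S hS hCM
  by_cases hQ : Scalar[S]
  · exact SquareGlueFree.hodgeConjectureFor_square_of_hodgeEndomorphisms_scalar hS.isSmoothProjective hQ
  exact hodgeConjectureFor_square_of_quadratic_nlAscent_of_three_le hB hmark hAsc hCell hS
    (quadratic_of_rank hmark hS hCM hQ hρ) (by omega)

end Summit.HodgeConjecture.HodgeConjecture.Theorems.MarkmanPartnerTransport.RealMultiplicationType

end
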